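import Summits.AtomisticToContinuum.Crystallization.Theorems.ExcessDecayLiouvilleCurrenciesSum
import Summits.AtomisticToContinuum.Crystallization.Theorems.ExcessDecayLiouvilleCurrenciesH
import Summits.AtomisticToContinuum.Crystallization.Theorems.ExcessDecayLiouvilleCurrenciesV

/-!
# Route `ExcessDecayLiouville`: the far currencies of `h = v + w` (nonlinear half, XXIV)

Harmonic-replacement architecture for item `ExcessDecay` (stmt-AtomisticToContinuum-9334), nonlinear half.
The inputs `𝐉[h, Y]` and `𝐉[Δ_τ h, Y]` of `linear_decay` for `h = v + w` in the currencies of the induction: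
* `farMass_h_le` : `𝐉[v + w, Y] ≤ 2(4096 C_e/Y² + 8192 R_s³ D_v²/(R_e⁷ Y)) + 2 Y⁻⁸ W`;
* `farMassDiff_h_le` : for a lattice vector `τ` with the ball inequality
  `Σ_{B_R} ‖v(q + Aτ) − v q‖² ≤ c_τ NN[v, R + 3]` and `Σ'‖Δ_τ w‖² ≤ c_τ E_w`,
  `𝐉[Δ_τ(v + w), Y] ≤ 2 c_τ (dyadic polynomial bound + 256 NN_tot/((r/64)⁷ Y)) + 2 Y⁻⁸ c_τ E_w`.
All `[folklore]`; helper lemmas, nothing here closes an item.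
-/

noncomputable section

namespace Summit.AtomisticToContinuum.Crystallization.Theorems.ExcessDecayLiouville

open scoped BigOperators Topology Classical
open Literature.MathematicalPhysics.StatisticalMechanics
open Summit.AtomisticToContinuum.Crystallization.Theorems.PhononStabilityNegative

set_option quotPrecheck false in
-- Local notation: ball indicator.
local notation "𝟙ᵇ[" x ", " c ", " R "]" => (if dist (x : EuclideanSpace ℝ (Fin 3)) c ≤ R then (1 : ℝ) else 0)

section

variable {t : Fin 2 → (EuclideanSpace ℝ (Fin 3))} {A : (EuclideanSpace ℝ (Fin 3)) →L[ℝ] (EuclideanSpace ℝ (Fin 3))}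
  {c₀ : EuclideanSpace ℝ (Fin 3)}

variable (hA : Adm₀ A) (hI : Inner₀ t A)

set_option quotPrecheck false in
-- local mass on the ball of radius `X` about `c₀`
local notation "𝐌[" f ", " X "]" =>
  tsum (fun p : Sites₀ t A => ‖f (p : EuclideanSpace ℝ (Fin 3))‖ ^ 2 * 𝟙ᵇ[p, c₀, X])
set_option quotPrecheck false in
-- weighted far mass with floor `Y` about `c₀`
local notation "𝐉[" f ", " Y "]" =>
  tsum (fun q : Sites₀ t A => ‖f (q : EuclideanSpace ℝ (Fin 3))‖ ^ 2 * (max (dist (q : EuclideanSpace ℝ (Fin 3)) c₀) Y)⁻¹ ^ 8)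
set_option quotPrecheck false in
-- Local notation: the finite near-neighbour form on the ball of radius `X` about `c₀`.
local notation "NN[" v ", " X "]" =>
  (∑ p ∈ (finite_sites_dist_le (t := t) (A := A) hA hI c₀ X).toFinset,
    ∑ q ∈ (finite_sites_dist_le (t := t) (A := A) hA hI c₀ X).toFinset,
      (if p ≠ q ∧ dist p q ≤ 11 / 10 then ‖v p - v q‖ ^ 2 else (0 : ℝ)))

include hA hI in
/-- **The far mass of `h = v + w`.** [folklore] -/
theorem farMass_h_le (v w : (EuclideanSpace ℝ (Fin 3)) → (EuclideanSpace ℝ (Fin 3)))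
    (hv : (Function.support v).Finite) (hw : (Function.support w).Finite)
    {C ρ Re D Rs Y W : ℝ} (hC : 0 ≤ C) (hRs : 1 ≤ Rs) (hRe : 0 < Re)
    (henv : ∀ x ∈ Sites₀ t A, dist x c₀ ≤ Re → ‖v x‖ ^ 2 ≤ C * (max (dist x c₀) ρ) ^ 3)
    (hvD : ∀ x, ‖v x‖ ≤ D) (hsupp : ∀ x ∈ Sites₀ t A, Rs < dist x c₀ → v x = 0)
    (hsupp' : ∀ x, v x ≠ 0 → x ∈ Sites₀ t A)
    (hY1 : 1 ≤ Y) (hρY : ρ ≤ Y) (hW : ∑' q : Sites₀ t A, ‖w q‖ ^ 2 ≤ W) :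
    𝐉[(fun x => v x + w x), Y] ≤ 2 * (4096 * C / Y ^ 2 + 8192 * Rs ^ 3 * D ^ 2 / (Re ^ 7 * Y)) + 2 * Y⁻¹ ^ 8 * W := by
  have hY0 : 0 < Y := by linarith
  have h1 := farMass_add_le (t := t) (A := A) (c₀ := c₀) hv hw hY0
  have h2 := farMass_le_cubic hA hI v hv hC hRs hRe henv hvD hsupp hsupp' hY1 hρY
  have hY8 : 0 ≤ Y⁻¹ ^ 8 := by positivity
  calc _ ≤ _ := h1
    _ ≤ _ := add_le_add (mul_le_mul_of_nonneg_left h2 (by norm_num)) (mul_le_mul_of_nonneg_left hW (by positivity))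

include hA hI in
/-- **The gradient far mass of `h = v + w` along one lattice vector** (see the module docstring).
[folklore] -/
theorem farMassDiff_h_le (v w : (EuclideanSpace ℝ (Fin 3)) → (EuclideanSpace ℝ (Fin 3)))
    (hv : (Function.support v).Finite) (hw : (Function.support w).Finite) (τ : EuclideanSpace ℝ (Fin 3))
    {cτ Y r q₁ q₂ q₃ q₄ q₅ Ntot Ew Rs : ℝ} (hcτ : 0 ≤ cτ) (hY : 3 ≤ Y) (hr : 192 ≤ r)
    (hq₁ : 0 ≤ q₁) (hq₂ : 0 ≤ q₂) (hq₃ : 0 ≤ q₃) (hq₄ : 0 ≤ q₄) (hq₅ : 0 ≤ q₅) (hN : 0 ≤ Ntot)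
    (hball : ∀ R : ℝ, ∑ q ∈ (finite_sites_dist_le (t := t) (A := A) hA hI c₀ R).toFinset, ‖v (q + A τ) - v q‖ ^ 2 ≤
      cτ * NN[v, R + 3])
    (hnear : ∀ a, Y ≤ a → 32 * a ≤ r → NN[v, a] ≤ q₁ * a + q₂ * a ^ 2 + q₃ * a ^ 3 + q₄ * a ^ 4 + q₅ * a ^ 5)
    (hfar : ∀ a, NN[v, a] ≤ Ntot)
    (hsuppv : ∀ x, v x ≠ 0 → dist x c₀ ≤ Rs) (hτ2 : ‖A τ‖ ≤ 2)
    (hΔw : ∑' q : Sites₀ t A, ‖(fun x => w (x + A τ) - w x) q‖ ^ 2 ≤ cτ * Ew) :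
    𝐉[(fun x => (fun y => v y + w y) (x + A τ) - (fun y => v y + w y) x), Y] ≤
      2 * (cτ * (2 * (4 * q₁ * Y + 4 ^ 2 * q₂ * Y ^ 2 + 4 ^ 3 * q₃ * Y ^ 3 + 4 ^ 4 * q₄ * Y ^ 4 + 4 ^ 5 * q₅ * Y ^ 5) / Y ^ 8 +
        256 * Ntot / ((r / 64) ^ 7 * Y))) + 2 * Y⁻¹ ^ 8 * (cτ * Ew) := by
  have hY0 : 0 < Y := by linarith
  have h1 := farMass_diff_add_le (t := t) (A := A) (c₀ := c₀) hv hw τ hY0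
  refine h1.trans (add_le_add (mul_le_mul_of_nonneg_left ?_ (by norm_num)) (mul_le_mul_of_nonneg_left hΔw (by positivity)))
  -- the dyadic decomposition of 𝐉[Δ_τ v, Y]
  obtain ⟨K, hK⟩ : ∃ K : ℕ, Rs + 2 ≤ 2 ^ (K + 1) * Y := by
    obtain ⟨K, hK⟩ := pow_unbounded_of_one_lt (Rs + 2) (by norm_num : (1 : ℝ) < 2)
    refine ⟨K, hK.le.trans ?_⟩
    calc (2 : ℝ) ^ K = 2 ^ K * 1 := (mul_one _).symm
      _ ≤ 2 ^ (K + 1) * Y := by rw [pow_succ]; nlinarith [pow_pos (by norm_num : (0 : ℝ) < 2) K]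
  have hKx : ∀ x, v (x + A τ) - v x ≠ 0 → dist x c₀ ≤ 2 ^ (K + 1) * Y := by
    intro x hx
    refine le_trans ?_ hK
    by_cases h0 : v x ≠ 0
    · linarith [hsuppv x h0]
    · push Not at h0
      have h1 : v (x + A τ) ≠ 0 := by intro h'; apply hx; rw [h', h0, sub_zero]
      have hd := hsuppv _ h1
      have : dist x c₀ ≤ dist (x + A τ) c₀ + ‖A τ‖ := by
        have h2 : dist x (x + A τ) = ‖A τ‖ := by
          rw [dist_eq_norm, show x - (x + A τ) = -(A τ) by abel, norm_neg]
        have := dist_triangle x (x + A τ) c₀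
        linarith
      linarith
  have hg0 : ∀ x, 0 ≤ (fun x => ‖v (x + A τ) - v x‖ ^ 2) x := fun x => by positivity
  have hvτ : (Function.support (fun x => v (x + A τ) - v x)).Finite := by
    refine ((hv.preimage (add_left_injective (A τ)).injOn).union hv).subset fun x hx => ?_
    simp only [Function.mem_support, ne_eq, Set.mem_union, Set.mem_preimage] at hx ⊢
    by_contra h
    push Not at h
    exact hx (by rw [h.1, h.2, sub_zero])
  have hgfin : (Function.support (fun x => ‖v (x + A τ) - v x‖ ^ 2)).Finite := by
    refine hvτ.subset fun x hx => ?_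
    simp only [Function.mem_support, ne_eq] at hx ⊢
    intro h0; apply hx; rw [h0, norm_zero]; ring
  have hK' : ∀ x, (fun x => ‖v (x + A τ) - v x‖ ^ 2) x ≠ 0 → dist x c₀ ≤ 2 ^ (K + 1) * Y := by
    intro x hx; apply hKx x; intro h0; apply hx; simp only []; rw [h0, norm_zero]; ring
  have hdy := farMass_le_dyadic (t := t) (A := A) (fun x => ‖v (x + A τ) - v x‖ ^ 2) hg0 hgfin c₀ hY0 K hK'
  refine hdy.trans ?_
  -- each ball term through NN
  have hballn : ∀ n : ℕ, ∑' q : Sites₀ t A, (fun x => ‖v (x + A τ) - v x‖ ^ 2) q *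
      (if dist (q : EuclideanSpace ℝ (Fin 3)) c₀ ≤ 2 ^ (n + 1) * Y then (1 : ℝ) else 0) ≤ cτ * NN[v, 2 ^ (n + 1) * Y + 3] := by
    intro n
    rw [tsum_indicator_eq_sum hA hI (fun x => ‖v (x + A τ) - v x‖ ^ 2) c₀ (2 ^ (n + 1) * Y)]
    exact hball _
  calc ∑ n ∈ Finset.range (K + 1), ((2 : ℝ) ^ n * Y)⁻¹ ^ 8 * ∑' q : Sites₀ t A,
        (fun x => ‖v (x + A τ) - v x‖ ^ 2) q * (if dist (q : EuclideanSpace ℝ (Fin 3)) c₀ ≤ 2 ^ (n + 1) * Y then (1 : ℝ) else 0)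
      ≤ ∑ n ∈ Finset.range (K + 1), ((2 : ℝ) ^ n * Y)⁻¹ ^ 8 * (cτ * NN[v, 2 ^ (n + 1) * Y + 3]) :=
        Finset.sum_le_sum fun n _ => mul_le_mul_of_nonneg_left (hballn n) (by positivity)
    _ = cτ * ∑ n ∈ Finset.range (K + 1), ((2 : ℝ) ^ n * Y)⁻¹ ^ 8 * (fun a => NN[v, a]) (2 ^ (n + 1) * Y + 3) := by
        rw [Finset.mul_sum]; exact Finset.sum_congr rfl fun n _ => by ring
    _ ≤ cτ * (2 * (4 * q₁ * Y + 4 ^ 2 * q₂ * Y ^ 2 + 4 ^ 3 * q₃ * Y ^ 3 + 4 ^ 4 * q₄ * Y ^ 4 + 4 ^ 5 * q₅ * Y ^ 5) / Y ^ 8 +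
        256 * Ntot / ((r / 64) ^ 7 * Y)) :=
        mul_le_mul_of_nonneg_left (dyadic_NN_sum_le (fun a => NN[v, a]) hY hr hq₁ hq₂ hq₃ hq₄ hq₅ hN hnear hfar K) hcτ

end

end Summit.AtomisticToContinuum.Crystallization.Theorems.ExcessDecayLiouville

end
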